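import Mathlib
import Literature.Analysis.FluidPDE.Tao2016AveragedNS.BoundedEternalSolutions
import Summits.NavierStokesRegularity.NavierStokesRegularity.Theorems.TaoLadderRungTwoBreakNoSurvivingEternalViscBddOneSmallActionRung
import HarnessLib

/-!
# The UPWARD-FLUX (no-backscatter) THROUGHPUT RECURSION for bounded admissible inviscid eternal solutions
# (helper toward (ρ0) `stub_noSurvivingEternalBddOne` of `TaoLadderRungTwoBreak.NoSurvivingEternalViscBddOne`,
# stmt-NavierStokesRegularity-20419; general `m`)

MODEL lattice ODEs only (Tao 2016 §4, §6.4; cell vocabulary `IsEternal`, `UniformBound`, `physEnergy`, `physFlux`); nothing here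
is a statement about the Navier–Stokes equations; no summit, crux or rung LEAF is proved (`--supports stmt-NavierStokesRegularity-20419`).

For a uniformly bounded admissible INVISCID eternal solution `W` of a cancelling table write `E_k = physEnergy`, `F_k = physFlux`
(flux through the bond `k → k+1`), `C_A = fluxConst α`, `κ₀ = 2C_AΛ⁻¹`.  The tree's two-index residue floor (`…ResidueFloor`)
carries an additive BACK-FLOW term of the order of the action, which is why no logarithmic action floor was available off the
self-similar stratum.  This module isolates the **sign-coherent class** «every bond flux is non-negative» (`0 ≤ F_k(σ)`, i.e.
`⟪W_{k+1}, A W_k⟫ ≥ 0`: energy only moves UP the ladder; it contains the positive cone of the dyadic member) and proves: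

* `integrable_physFlux` — every bond flux is integrable on `ℝ` (`|F_k| ≤ κ₀‖W_{k+1}‖·sup E_k`);
* `physEnergy_eq_sub_integral_Iic` — `E_{k+1}(σ) = ∫_{-∞}^{σ}F_k − ∫_{-∞}^{σ}F_{k+1}` (shell identity from the far past);
* `physEnergy_ge_retention` — **no-backscatter retention**: if `F_k ≥ 0` on `[σ⋆, σ]` then
  `E_{k+1}(σ) ≥ exp(−κ₀∫_{σ⋆}^{σ}‖W_{k+2}‖)·E_{k+1}(σ⋆)`;
* `throughput_succ_le` — **THE THROUGHPUT RECURSION**: with `Φ_j = ∫_ℝ F_j` and `κ ≥ κ₀∫‖W_{k+2}‖`,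
  `Φ_{k+1} ≤ (1 − e^{−κ}/(1+κ))·Φ_k` — every shell keeps the fraction `e^{−κ}/(1+κ)` of what reaches it as a permanent WAKE.

The survival consequences (logarithmic action floor, the slice of `NoSurvivingEternalBdd R 1`) are in the sequel
`…UpwardFluxRung`.  HONEST LABEL: a rung; (ρ0), (ρ+), ⟨20419⟩ and every NS statement remain OPEN.
-/

noncomputable section

-- the summit and its single sub-problem share the name (CONVENTIONS §1)
set_option linter.dupNamespace false

namespace Summit.NavierStokesRegularity.NavierStokesRegularity.Theorems.NoSurvivingEternalViscBddOne.UpwardFlux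

open Set Filter Topology MeasureTheory
open scoped RealInnerProductSpace
open Literature.Analysis.FluidPDE Literature.Analysis.FluidPDE.TaoCascade
open Summit.NavierStokesRegularity.NavierStokesRegularity.Theorems.NoSurvivingEternalViscBddOne.SmallAction
  (continuous_physEnergy continuous_physFlux tendsto_physEnergy_atBot exists_physEnergy_le)

variable {m : ℕ} {ε₀ νh : ℝ} {α : Fin m → Fin m → Fin m → ℤ × ℤ × ℤ → ℝ} {W : ℤ → ℝ → Em m}

/-! ## Integrability of the bond fluxes and the shell identity from the far past -/

/-- Every bond flux of a uniformly bounded admissible eternal solution (any `ν̂ ≥ 0`) of a cancelling table is integrable on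
`ℝ`: `|F_k| ≤ 2C_AΛ⁻¹‖W_{k+1}‖·sup E_k` and `‖W_{k+1}‖` is integrable (the action clause).
[cite: Tao2016AveragedNS, §4 Lemma 4.1 (4.9)–(4.10), §6.4; tree `abs_physFlux_le`] -/
theorem integrable_physFlux (hε : 0 < ε₀) (hW : IsEternalVisc ε₀ νh α W) (hc : IsCancellingCoeff α)
    (hU : UniformBound W) (k : ℤ) : Integrable (physFlux ε₀ α W k) := by
  obtain ⟨S, hS⟩ := exists_physEnergy_le hε hW hU k
  obtain ⟨M, hM⟩ := hW.action
  have hint : Integrable (fun σ => ‖W (k + 1) σ‖) := (hM (k + 1)).1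
  have hS0 : 0 ≤ S := (physEnergy_nonneg ε₀ W k 0).trans (hS 0)
  have hκ₀nn : 0 ≤ 2 * fluxConst α * (bigLam ε₀)⁻¹ := by
    have := fluxConst_nonneg α; have := (bigLam_pos (by linarith : (-1 : ℝ) < ε₀)).le; positivity
  refine Integrable.mono' (hint.const_mul (2 * fluxConst α * (bigLam ε₀)⁻¹ * S))
    (continuous_physFlux hW hc k).aestronglyMeasurable (Eventually.of_forall fun σ => ?_)
  have h := abs_physFlux_le hε hc W k σ
  rw [Real.norm_eq_abs]
  calc |physFlux ε₀ α W k σ| ≤ 2 * fluxConst α * (bigLam ε₀)⁻¹ * ‖W (k + 1) σ‖ * physEnergy ε₀ W k σ := h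
    _ ≤ 2 * fluxConst α * (bigLam ε₀)⁻¹ * ‖W (k + 1) σ‖ * S :=
        mul_le_mul_of_nonneg_left (hS σ) (mul_nonneg hκ₀nn (norm_nonneg _))
    _ = 2 * fluxConst α * (bigLam ε₀)⁻¹ * S * ‖W (k + 1) σ‖ := by ring

/-- **The shell identity integrated from the far past** (inviscid): `E_{k+1}(σ) = ∫_{-∞}^{σ}F_k − ∫_{-∞}^{σ}F_{k+1}` — shell `k+1`
holds exactly the traffic that came up through the bond `k → k+1` minus what went on through `k+1 → k+2` (`E_{k+1}(−∞) = 0`).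
[cite: Tao2016AveragedNS, §4 Lemma 4.1 (4.8)–(4.10) with (4.3), §6.4; tree `hasDerivAt_physEnergy`] -/
theorem physEnergy_eq_sub_integral_Iic (hε : 0 < ε₀) (hW : IsEternal ε₀ α W) (hc : IsCancellingCoeff α)
    (hU : UniformBound W) (k : ℤ) (σ : ℝ) :
    physEnergy ε₀ W (k + 1) σ
      = (∫ s in Iic σ, physFlux ε₀ α W k s) - ∫ s in Iic σ, physFlux ε₀ α W (k + 1) s := by
  have hW' : IsEternalVisc ε₀ 0 α W := hW.isEternalVisc
  have hFk := integrable_physFlux hε hW' hc hU k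
  have hFk1 := integrable_physFlux hε hW' hc hU (k + 1)
  have cFk := continuous_physFlux hW' hc k
  have cFk1 := continuous_physFlux hW' hc (k + 1)
  -- the derivative of `E_{k+1}` is `F_k - F_{k+1}` (no viscosity)
  have hderiv : ∀ s, HasDerivAt (physEnergy ε₀ W (k + 1))
      (physFlux ε₀ α W k s - physFlux ε₀ α W (k + 1) s) s := by
    intro s
    have h := hasDerivAt_physEnergy hε hW' hc (k + 1) s
    have hv : viscCoef ε₀ 0 (k + 1) s = 0 := by unfold viscCoef; ring
    rw [hv, add_sub_cancel_right] at h
    simpa using h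
  -- FTC on `[a, σ]`
  have hftc : ∀ a, a ≤ σ → physEnergy ε₀ W (k + 1) σ - physEnergy ε₀ W (k + 1) a
      = (∫ s in a..σ, physFlux ε₀ α W k s) - ∫ s in a..σ, physFlux ε₀ α W (k + 1) s := by
    intro a _
    rw [← intervalIntegral.integral_sub (cFk.intervalIntegrable _ _) (cFk1.intervalIntegrable _ _)]
    exact (intervalIntegral.integral_eq_sub_of_hasDerivAt (fun s _ => hderiv s)
      ((cFk.sub cFk1).intervalIntegrable _ _)).symm
  -- send `a → -∞`
  have hlim1 : Tendsto (fun a : ℝ => physEnergy ε₀ W (k + 1) σ - physEnergy ε₀ W (k + 1) a) atBot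
      (𝓝 (physEnergy ε₀ W (k + 1) σ - 0)) :=
    tendsto_const_nhds.sub (tendsto_physEnergy_atBot hε hU (k + 1))
  have hlim2 : Tendsto (fun a : ℝ => (∫ s in a..σ, physFlux ε₀ α W k s) - ∫ s in a..σ, physFlux ε₀ α W (k + 1) s)
      atBot (𝓝 ((∫ s in Iic σ, physFlux ε₀ α W k s) - ∫ s in Iic σ, physFlux ε₀ α W (k + 1) s)) :=
    (intervalIntegral_tendsto_integral_Iic σ hFk.integrableOn tendsto_id).sub
      (intervalIntegral_tendsto_integral_Iic σ hFk1.integrableOn tendsto_id)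
  have heq : (fun a : ℝ => physEnergy ε₀ W (k + 1) σ - physEnergy ε₀ W (k + 1) a)
      =ᶠ[atBot] (fun a : ℝ => (∫ s in a..σ, physFlux ε₀ α W k s) - ∫ s in a..σ, physFlux ε₀ α W (k + 1) s) := by
    filter_upwards [eventually_le_atBot σ] with a ha using hftc a ha
  have := tendsto_nhds_unique (hlim1.congr' heq) hlim2
  rw [sub_zero] at this
  exact this

/-! ## Cumulative throughputs of a non-negative flux -/

/-- For a non-negative integrable flux, the cumulative throughput `∫_{-∞}^{σ}F` is monotone in `σ`. [folklore] -/
theorem integral_Iic_mono_of_nonneg {F : ℝ → ℝ} (hF : Integrable F) (hnn : ∀ s, 0 ≤ F s) {σ₁ σ₂ : ℝ}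
    (h : σ₁ ≤ σ₂) : (∫ s in Iic σ₁, F s) ≤ ∫ s in Iic σ₂, F s :=
  setIntegral_mono_set hF.integrableOn (Eventually.of_forall hnn) (Eventually.of_forall fun _ hs => Iic_subset_Iic.2 h hs)

/-- For a non-negative integrable flux, `∫_{-∞}^{σ}F ≤ ∫_ℝ F`. [folklore] -/
theorem integral_Iic_le_integral_of_nonneg {F : ℝ → ℝ} (hF : Integrable F) (hnn : ∀ s, 0 ≤ F s) (σ : ℝ) :
    (∫ s in Iic σ, F s) ≤ ∫ s, F s :=
  setIntegral_le_integral hF (Eventually.of_forall hnn)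

/-- For a non-negative integrable flux, a bound on every cumulative throughput bounds the total one:
`(∀ σ, ∫_{-∞}^{σ}F ≤ c) → ∫_ℝ F ≤ c`. [folklore] -/
theorem integral_le_of_integral_Iic_le {F : ℝ → ℝ} (hF : Integrable F) (hnn : ∀ s, 0 ≤ F s) {c : ℝ}
    (h : ∀ σ, (∫ s in Iic σ, F s) ≤ c) : (∫ s, F s) ≤ c := by
  have hlim : Tendsto (fun i : ℕ => ∫ s in (-(i : ℝ))..(i : ℝ), F s) atTop (𝓝 (∫ s, F s)) :=
    intervalIntegral_tendsto_integral hF (tendsto_neg_atTop_atBot.comp tendsto_natCast_atTop_atTop)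
      tendsto_natCast_atTop_atTop
  refine le_of_tendsto hlim (Eventually.of_forall fun i => ?_)
  have hi : (-(i : ℝ)) ≤ (i : ℝ) := by have := (Nat.cast_nonneg i : (0 : ℝ) ≤ i); linarith
  rw [intervalIntegral.integral_of_le hi]
  calc (∫ s in Ioc (-(i : ℝ)) (i : ℝ), F s) ≤ ∫ s in Iic (i : ℝ), F s :=
        setIntegral_mono_set hF.integrableOn (Eventually.of_forall hnn)
          (Eventually.of_forall fun _ hs => hs.2)
    _ ≤ c := h i

/-! ## No-backscatter retention -/

/-- **No-backscatter retention.**  For an admissible INVISCID eternal solution of a cancelling table: if the flux INTO shell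
`k+1` is non-negative on `[σ⋆, σ]` (`0 ≤ F_k`), then `exp(−Θ)·E_{k+1}(σ⋆) ≤ E_{k+1}(σ)` for any
`Θ ≥ ∫_{σ⋆}^{σ} 2C_AΛ⁻¹‖W_{k+2}‖` — what the shell holds can only leave through the bond above it, at relative rate at
most `2C_AΛ⁻¹‖W_{k+2}‖` (`|F_{k+1}| ≤ 2C_AΛ⁻¹‖W_{k+2}‖E_{k+1}`).  The tree's two-index residue floor without its back-flow term.
[cite: Tao2016AveragedNS, §4 Lemma 4.1 (4.8)–(4.10) with (4.3), §6.4; tree `hasDerivAt_physEnergy`, `abs_physFlux_le`] -/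
theorem physEnergy_ge_retention (hε : 0 < ε₀) (hW : IsEternal ε₀ α W) (hc : IsCancellingCoeff α)
    (k : ℤ) {σs σ : ℝ} (hle : σs ≤ σ) (hF : ∀ s ∈ Icc σs σ, 0 ≤ physFlux ε₀ α W k s) {Θ : ℝ}
    (hΘ : ∫ s in σs..σ, 2 * fluxConst α * (bigLam ε₀)⁻¹ * ‖W (k + 2) s‖ ≤ Θ) :
    Real.exp (-Θ) * physEnergy ε₀ W (k + 1) σs ≤ physEnergy ε₀ W (k + 1) σ := by
  have hW' : IsEternalVisc ε₀ 0 α W := hW.isEternalVisc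
  set κ₀ := 2 * fluxConst α * (bigLam ε₀)⁻¹ with hκ₀
  have hΛ : 0 < bigLam ε₀ := bigLam_pos (by linarith)
  have hκ₀nn : 0 ≤ κ₀ := by have := fluxConst_nonneg α; positivity
  have hk2 : k + 1 + 1 = k + 2 := by ring
  -- continuity of the players
  have cWk2 : Continuous (W (k + 2)) := continuous_iff_continuousAt.2 fun s => (hW'.law (k + 2) s).continuousAt
  have cE : Continuous (physEnergy ε₀ W (k + 1)) := continuous_physEnergy hW' (k + 1)
  -- the rate `θ ≥ 0` and its primitive `P`
  set θ : ℝ → ℝ := fun s => κ₀ * ‖W (k + 2) s‖ with hθ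
  have cθ : Continuous θ := by simp only [hθ]; fun_prop
  have hθnn : ∀ s, 0 ≤ θ s := fun s => mul_nonneg hκ₀nn (norm_nonneg _)
  set P : ℝ → ℝ := fun u => ∫ x in σs..u, θ x with hP
  have hPderiv : ∀ u, HasDerivAt P (θ u) u := fun u => (cθ.integral_hasStrictDerivAt σs u).hasDerivAt
  have cP : Continuous P := continuous_iff_continuousAt.2 fun u => (hPderiv u).continuousAt
  have hP0 : P σs = 0 := by simp [hP]
  have hPσ : P σ ≤ Θ := hΘ
  -- the derivative of `E_{k+1}` (inviscid: the viscous term vanishes)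
  set D : ℝ → ℝ := fun s => physFlux ε₀ α W (k + 1 - 1) s - physFlux ε₀ α W (k + 1) s
      - 2 * viscCoef ε₀ 0 (k + 1) s * physEnergy ε₀ W (k + 1) s with hD
  have hEderiv : ∀ s, HasDerivAt (physEnergy ε₀ W (k + 1)) (D s) s := fun s =>
    hasDerivAt_physEnergy hε hW' hc (k + 1) s
  have cD : Continuous D := by
    have h1 := continuous_physFlux hW' hc (k + 1 - 1)
    have h2 := continuous_physFlux hW' hc (k + 1)
    have h3 : Continuous fun s => viscCoef ε₀ 0 (k + 1) s := by unfold viscCoef; fun_prop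
    simp only [hD]; fun_prop
  -- the weighted energy `Ψ = e^{P} E_{k+1}` is non-decreasing on `[σ⋆, σ]`
  set Ψ : ℝ → ℝ := fun s => Real.exp (P s) * physEnergy ε₀ W (k + 1) s with hΨ
  set Ψ' : ℝ → ℝ := fun s => Real.exp (P s) * θ s * physEnergy ε₀ W (k + 1) s + Real.exp (P s) * D s with hΨ'
  have hΨderiv : ∀ s, HasDerivAt Ψ (Ψ' s) s := by
    intro s
    have h1 : HasDerivAt (fun u => Real.exp (P u)) (Real.exp (P s) * θ s) s := (hPderiv s).exp
    exact h1.mul (hEderiv s)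
  have cΨ' : Continuous Ψ' := by
    have : Continuous fun s => Real.exp (P s) := cP.rexp
    simp only [hΨ']; fun_prop
  have hpos : ∀ s ∈ Icc σs σ, 0 ≤ Ψ' s := by
    intro s hs
    have hEk := physEnergy_nonneg ε₀ W (k + 1) s
    have heP : 0 < Real.exp (P s) := Real.exp_pos _
    have hv : viscCoef ε₀ 0 (k + 1) s = 0 := by unfold viscCoef; ring
    have hFk1 : physFlux ε₀ α W (k + 1) s ≤ κ₀ * ‖W (k + 2) s‖ * physEnergy ε₀ W (k + 1) s := by
      have := (le_abs_self _).trans (abs_physFlux_le hε hc W (k + 1) s)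
      rw [hk2] at this; rw [hκ₀]; linarith
    have hFk : 0 ≤ physFlux ε₀ α W (k + 1 - 1) s := by rw [add_sub_cancel_right]; exact hF s hs
    have hsum : 0 ≤ θ s * physEnergy ε₀ W (k + 1) s + D s := by
      simp only [hθ, hD, hv]; nlinarith
    have : Ψ' s = Real.exp (P s) * (θ s * physEnergy ε₀ W (k + 1) s + D s) := by simp only [hΨ']; ring
    rw [this]
    exact mul_nonneg heP.le hsum
  -- integrate over `[σ⋆, σ]`
  have hftc : ∫ s in σs..σ, Ψ' s = Ψ σ - Ψ σs :=
    intervalIntegral.integral_eq_sub_of_hasDerivAt (fun s _ => hΨderiv s) (cΨ'.intervalIntegrable _ _)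
  have hint0 : 0 ≤ ∫ s in σs..σ, Ψ' s :=
    intervalIntegral.integral_nonneg hle fun s hs => hpos s hs
  have hΨs : Ψ σs = physEnergy ε₀ W (k + 1) σs := by simp [hΨ, hP0]
  have hΨσ : Ψ σ = Real.exp (P σ) * physEnergy ε₀ W (k + 1) σ := rfl
  have hkey : physEnergy ε₀ W (k + 1) σs ≤ Real.exp (P σ) * physEnergy ε₀ W (k + 1) σ := by
    rw [← hΨσ, ← hΨs]; linarith
  -- divide by `e^{Pσ}` and use `Pσ ≤ Θ`
  have hEσ := physEnergy_nonneg ε₀ W (k + 1) σ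
  have hEs := physEnergy_nonneg ε₀ W (k + 1) σs
  have e1 : Real.exp (-P σ) * Real.exp (P σ) = 1 := by rw [← Real.exp_add, neg_add_cancel, Real.exp_zero]
  have h2 : Real.exp (-P σ) * physEnergy ε₀ W (k + 1) σs ≤ physEnergy ε₀ W (k + 1) σ := by
    have h := mul_le_mul_of_nonneg_left hkey (Real.exp_pos (-P σ)).le
    rwa [← mul_assoc, e1, one_mul] at h
  have hexp : Real.exp (-Θ) ≤ Real.exp (-P σ) := Real.exp_le_exp.2 (by linarith)
  calc Real.exp (-Θ) * physEnergy ε₀ W (k + 1) σs ≤ Real.exp (-P σ) * physEnergy ε₀ W (k + 1) σs :=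
        mul_le_mul_of_nonneg_right hexp hEs
    _ ≤ physEnergy ε₀ W (k + 1) σ := h2

/-! ## The throughput recursion -/

/-- **THE THROUGHPUT RECURSION** (inviscid, all bond fluxes non-negative).  With `Φ_j = ∫_ℝ F_j` the total traffic of the bond
`j → j+1` and `κ = 2C_AΛ⁻¹·a`, `a ≥ ∫‖W_{k+2}‖` (the action of the shell above):
`Φ_{k+1} ≤ (1 − e^{−κ}/(1+κ))·Φ_k` — shell `k+1` keeps the fraction `e^{−κ}/(1+κ)` of everything that reaches it as a
permanent wake.  (Retention bounds the wake below by `e^{−κ}·sup E_{k+1}`; the far-past shell identity and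
`Φ_{k+1} ≤ κ·sup E_{k+1}` bound `sup E_{k+1}` below by `Φ_k/(1+κ)`.)
[cite: Tao2016AveragedNS, §4 Lemma 4.1 (4.8)–(4.10) with (4.3), §6.4; this file] -/
theorem throughput_succ_le (hε : 0 < ε₀) (hW : IsEternal ε₀ α W) (hc : IsCancellingCoeff α) (hU : UniformBound W)
    (hF : ∀ (j : ℤ) (s : ℝ), 0 ≤ physFlux ε₀ α W j s) (k : ℤ) {a : ℝ} (ha : ∫ s, ‖W (k + 2) s‖ ≤ a) :
    (∫ s, physFlux ε₀ α W (k + 1) s)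
      ≤ (1 - Real.exp (-(2 * fluxConst α * (bigLam ε₀)⁻¹ * a)) / (1 + 2 * fluxConst α * (bigLam ε₀)⁻¹ * a))
        * ∫ s, physFlux ε₀ α W k s := by
  have hW' : IsEternalVisc ε₀ 0 α W := hW.isEternalVisc
  set κ₀ := 2 * fluxConst α * (bigLam ε₀)⁻¹ with hκ₀
  have hΛ : 0 < bigLam ε₀ := bigLam_pos (by linarith)
  have hκ₀nn : 0 ≤ κ₀ := by have := fluxConst_nonneg α; positivity
  obtain ⟨Mact, hMact⟩ := hW.action
  have hint2 : Integrable (fun s => ‖W (k + 2) s‖) := (hMact (k + 2)).1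
  have ha0 : 0 ≤ a := le_trans (integral_nonneg fun s => norm_nonneg _) ha
  set κ := κ₀ * a with hκdef
  have hκnn : 0 ≤ κ := mul_nonneg hκ₀nn ha0
  have h1κ : 0 < 1 + κ := by linarith
  have hFk := integrable_physFlux hε hW' hc hU k
  have hFk1 := integrable_physFlux hε hW' hc hU (k + 1)
  set x := ∫ s, physFlux ε₀ α W k s with hx
  set y := ∫ s, physFlux ε₀ α W (k + 1) s with hy
  set E : ℝ → ℝ := physEnergy ε₀ W (k + 1) with hE
  have hEnn : ∀ s, 0 ≤ E s := fun s => physEnergy_nonneg ε₀ W (k + 1) s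
  -- the far-past identity `E(σ) = ∫_{-∞}^{σ}F_k − ∫_{-∞}^{σ}F_{k+1}`
  have hid : ∀ σ, E σ = (∫ s in Iic σ, physFlux ε₀ α W k s) - ∫ s in Iic σ, physFlux ε₀ α W (k + 1) s :=
    fun σ => physEnergy_eq_sub_integral_Iic hε hW hc hU k σ
  have hIk : ∀ σ, (∫ s in Iic σ, physFlux ε₀ α W k s) ≤ x := fun σ =>
    integral_Iic_le_integral_of_nonneg hFk (hF k) σ
  -- retention with the whole action of shell `k+2`: `e^{-κ} E(σ⋆) ≤ E(σ)` for `σ⋆ ≤ σ`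
  have hret : ∀ σs σ, σs ≤ σ → Real.exp (-κ) * E σs ≤ E σ := by
    intro σs σ hle
    refine physEnergy_ge_retention hε hW hc k hle (fun s _ => hF k s) ?_
    rw [intervalIntegral.integral_const_mul]
    refine mul_le_mul_of_nonneg_left ?_ hκ₀nn
    rw [intervalIntegral.integral_of_le hle]
    exact (setIntegral_le_integral hint2 (Eventually.of_forall fun s => norm_nonneg _)).trans ha
  -- Step A: `y ≤ x − e^{-κ} E(σ⋆)` for every `σ⋆`
  have hA : ∀ σs, y ≤ x - Real.exp (-κ) * E σs := by
    intro σs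
    refine integral_le_of_integral_Iic_le hFk1 (hF (k + 1)) fun σ => ?_
    rcases le_total σs σ with hle | hle
    · have h1 : (∫ s in Iic σ, physFlux ε₀ α W (k + 1) s) = (∫ s in Iic σ, physFlux ε₀ α W k s) - E σ := by
        rw [hid σ]; ring
      rw [h1]
      linarith [hIk σ, hret σs σ hle]
    · have h1 : (∫ s in Iic σs, physFlux ε₀ α W (k + 1) s) = (∫ s in Iic σs, physFlux ε₀ α W k s) - E σs := by
        rw [hid σs]; ring
      have hmono := integral_Iic_mono_of_nonneg hFk1 (hF (k + 1)) hle
      have hexp1 : Real.exp (-κ) ≤ 1 := Real.exp_le_one_iff.2 (by linarith)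
      have h3 : Real.exp (-κ) * E σs ≤ E σs := by
        have := mul_le_mul_of_nonneg_right hexp1 (hEnn σs); rwa [one_mul] at this
      linarith [hIk σs]
  -- Step B: the shell energy is bounded by `e^{κ}(x − y)`
  have hexpκ : 0 < Real.exp κ := Real.exp_pos κ
  have eκ : Real.exp κ * Real.exp (-κ) = 1 := by rw [← Real.exp_add, add_neg_cancel, Real.exp_zero]
  have hB : ∀ σ, E σ ≤ Real.exp κ * (x - y) := by
    intro σ
    have h := mul_le_mul_of_nonneg_left (show Real.exp (-κ) * E σ ≤ x - y by linarith [hA σ]) hexpκ.le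
    rwa [← mul_assoc, eκ, one_mul] at h
  -- Step C: `x ≤ e^{κ}(x − y) + y`
  have hC : x ≤ Real.exp κ * (x - y) + y := by
    refine integral_le_of_integral_Iic_le hFk (hF k) fun σ => ?_
    have h1 : (∫ s in Iic σ, physFlux ε₀ α W k s) = E σ + ∫ s in Iic σ, physFlux ε₀ α W (k + 1) s := by
      rw [hid σ]; ring
    rw [h1]
    linarith [hB σ, integral_Iic_le_integral_of_nonneg hFk1 (hF (k + 1)) σ]
  -- Step D: `y ≤ κ e^{κ}(x − y)` (`F_{k+1} ≤ κ₀‖W_{k+2}‖E_{k+1}`)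
  have hD : y ≤ κ * (Real.exp κ * (x - y)) := by
    have hpt : ∀ s, physFlux ε₀ α W (k + 1) s ≤ κ₀ * (Real.exp κ * (x - y)) * ‖W (k + 2) s‖ := by
      intro s
      have h := (le_abs_self _).trans (abs_physFlux_le hε hc W (k + 1) s)
      rw [show k + 1 + 1 = k + 2 by ring] at h
      calc physFlux ε₀ α W (k + 1) s ≤ 2 * fluxConst α * (bigLam ε₀)⁻¹ * ‖W (k + 2) s‖ * physEnergy ε₀ W (k + 1) s := h
        _ ≤ 2 * fluxConst α * (bigLam ε₀)⁻¹ * ‖W (k + 2) s‖ * (Real.exp κ * (x - y)) :=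
            mul_le_mul_of_nonneg_left (hB s) (mul_nonneg hκ₀nn (norm_nonneg _))
        _ = κ₀ * (Real.exp κ * (x - y)) * ‖W (k + 2) s‖ := by rw [hκ₀]; ring
    have hP'nn : 0 ≤ Real.exp κ * (x - y) := (hEnn 0).trans (hB 0)
    calc y ≤ ∫ s, κ₀ * (Real.exp κ * (x - y)) * ‖W (k + 2) s‖ :=
          integral_mono hFk1 (hint2.const_mul _) hpt
      _ = κ₀ * (Real.exp κ * (x - y)) * ∫ s, ‖W (k + 2) s‖ := integral_const_mul _ _
      _ ≤ κ₀ * (Real.exp κ * (x - y)) * a := mul_le_mul_of_nonneg_left ha (mul_nonneg hκ₀nn hP'nn)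
      _ = κ * (Real.exp κ * (x - y)) := by rw [hκdef]; ring
  -- combine: `x ≤ (1+κ) e^{κ} (x − y)`, i.e. `e^{-κ} x ≤ (1+κ)(x − y)`
  have h1 : x ≤ (1 + κ) * (Real.exp κ * (x - y)) := by linarith
  have h2 : Real.exp (-κ) * x ≤ (1 + κ) * (x - y) := by
    have h := mul_le_mul_of_nonneg_left h1 (Real.exp_pos (-κ)).le
    calc Real.exp (-κ) * x ≤ Real.exp (-κ) * ((1 + κ) * (Real.exp κ * (x - y))) := h
      _ = (1 + κ) * (x - y) * (Real.exp κ * Real.exp (-κ)) := by ring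
      _ = (1 + κ) * (x - y) := by rw [eκ, mul_one]
  have h3 : Real.exp (-κ) / (1 + κ) * x ≤ x - y := by
    rw [div_mul_eq_mul_div, div_le_iff₀ h1κ]; linarith
  show y ≤ (1 - Real.exp (-κ) / (1 + κ)) * x
  linarith

/-- The retained fraction `e^{−κ}/(1+κ)` lies in `(0, 1]` for `κ ≥ 0`, so the throughput ratio `1 − e^{−κ}/(1+κ)` lies in `[0, 1)`.
[folklore] -/
theorem ratio_bounds {κ : ℝ} (hκ : 0 ≤ κ) :
    0 ≤ 1 - Real.exp (-κ) / (1 + κ) ∧ 1 - Real.exp (-κ) / (1 + κ) < 1 := by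
  have h1κ : 0 < 1 + κ := by linarith
  have hexp1 : Real.exp (-κ) ≤ 1 := Real.exp_le_one_iff.2 (by linarith)
  constructor
  · have : Real.exp (-κ) / (1 + κ) ≤ 1 := by rw [div_le_one h1κ]; linarith
    linarith
  · have : 0 < Real.exp (-κ) / (1 + κ) := div_pos (Real.exp_pos _) h1κ
    linarith

end Summit.NavierStokesRegularity.NavierStokesRegularity.Theorems.NoSurvivingEternalViscBddOne.UpwardFlux

end
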